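import Mathlib
import Literature.Probability.PointProcesses.LensConsistentLaw
import Literature.MathematicalPhysics.StatisticalMechanics.LennardJonesClusters
import Summits.AtomisticToContinuum.Crystallization.Theorems.ChargedEnergyGap.Negative.Periodisation
import Summits.AtomisticToContinuum.Crystallization.Theorems.ChargedEnergyGap.Negative.BlocksBound
import HarnessLib

/-!
# Crux `PatternPricedCertificates` (stmt-AtomisticToContinuum-12974), line `registered`: stub `stub_clusterEnergyBound`

Finite-cluster Lennard-Jones energy bound with boundary correction: `|Y| e⋆ ≤ Σ_{w∈Y} [½ Σ_{z ∈ T∖{w}, ‖z−w‖≤ρ} V‖z−w‖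
+ (1/24) #{z ∈ T∖Y : ‖z−w‖ ≤ ρ}]` for `Y ⊆ T`, `ρ ≥ 1`. Helper for `stub_unpricedMeanBound`.
-/

noncomputable section

open scoped BigOperators Classical
open MeasureTheory

namespace Summit.AtomisticToContinuum.Crystallization.Theorems.PatternPricedCertificates

open Literature.MathematicalPhysics.StatisticalMechanics
open Summit.AtomisticToContinuum.Crystallization.Theorems.ChargedEnergyGapNegative

/-- **Per-site bound.** For `w ∈ Y ⊆ T` and `ρ ≥ 1`: half the full intra-cluster site energy
`½ Σ_{z ∈ Y∖{w}} V_LJ ‖z − w‖` is at most the truncated site energy in `T` plus `1/24` per cross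
neighbour: the truncated sum splits into the part inside `Y` (which dominates the untruncated one,
the dropped terms having `‖z − w‖ > ρ ≥ 1`, where `V_LJ ≤ 0`) and the cross part, each of whose
terms is `≥ −1/12`. [folklore] -/
theorem clusterEnergyBound_site {ρ : ℝ} (hρ : 1 ≤ ρ) {T Y : Finset (EuclideanSpace ℝ (Fin 3))}
    (hYT : Y ⊆ T) {w : EuclideanSpace ℝ (Fin 3)} (hw : w ∈ Y) :
    (∑ z ∈ Y.erase w, lennardJones ‖z - w‖) / 2 ≤
      (∑ z ∈ (T.erase w).filter (fun z => ‖z - w‖ ≤ ρ), lennardJones ‖z - w‖) / 2 +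
        (1 / 24) * ((((T \ Y).filter (fun z => ‖z - w‖ ≤ ρ)).card : ℝ)) := by
  have hsplit : (T.erase w).filter (fun z => ‖z - w‖ ≤ ρ) =
      (Y.erase w).filter (fun z => ‖z - w‖ ≤ ρ) ∪ (T \ Y).filter (fun z => ‖z - w‖ ≤ ρ) := by
    ext z
    simp only [Finset.mem_filter, Finset.mem_erase, Finset.mem_union, Finset.mem_sdiff]
    by_cases hz : z ∈ Y
    · have hzT : z ∈ T := hYT hz
      tauto
    · have hzw : z ≠ w := fun h => hz (h ▸ hw)
      tauto
  have hdisj : Disjoint ((Y.erase w).filter (fun z => ‖z - w‖ ≤ ρ))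
      ((T \ Y).filter (fun z => ‖z - w‖ ≤ ρ)) := by
    rw [Finset.disjoint_left]
    intro z hz1 hz2
    simp only [Finset.mem_filter, Finset.mem_erase, Finset.mem_sdiff] at hz1 hz2
    exact hz2.1.2 hz1.1.2
  rw [hsplit, Finset.sum_union hdisj]
  have hB : ((T \ Y).filter (fun z => ‖z - w‖ ≤ ρ)).card • (-1 / 12 : ℝ) ≤
      ∑ z ∈ (T \ Y).filter (fun z => ‖z - w‖ ≤ ρ), lennardJones ‖z - w‖ :=
    Finset.card_nsmul_le_sum _ _ _ fun z _ => neg_one_div_le_lennardJones _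
  rw [nsmul_eq_mul] at hB
  have hA : ∑ z ∈ Y.erase w, lennardJones ‖z - w‖ ≤
      ∑ z ∈ (Y.erase w).filter (fun z => ‖z - w‖ ≤ ρ), lennardJones ‖z - w‖ := by
    rw [← Finset.sum_filter_add_sum_filter_not (Y.erase w) (fun z => ‖z - w‖ ≤ ρ)]
    have : ∑ z ∈ (Y.erase w).filter (fun z => ¬ ‖z - w‖ ≤ ρ), lennardJones ‖z - w‖ ≤ 0 :=
      Finset.sum_nonpos fun z hz => by
        simp only [Finset.mem_filter, not_le] at hz
        exact lennardJones_nonpos (by linarith [hz.2])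
    linarith
  linarith

/-- **Double-sum form of the interaction energy of a finite set.** Enumerating `Y` by
`Y.equivFin`, `Σ_{w ∈ Y} Σ_{z ∈ Y∖{w}} V_LJ ‖z − w‖ = 2 E_LJ` (`two_mul_interactionEnergy`,
reindexed along the enumeration). [folklore] -/
theorem sum_sum_erase_eq_two_mul_interactionEnergy (Y : Finset (EuclideanSpace ℝ (Fin 3))) :
    ∑ w ∈ Y, ∑ z ∈ Y.erase w, lennardJones ‖z - w‖ =
      2 * interactionEnergy lennardJones
        (fun i : Fin Y.card => (Y.equivFin.symm i : EuclideanSpace ℝ (Fin 3))) := by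
  set x : Fin Y.card → EuclideanSpace ℝ (Fin 3) :=
    fun i => (Y.equivFin.symm i : EuclideanSpace ℝ (Fin 3))
  have hx : Function.Injective x := fun i j h => Y.equivFin.symm.injective (Subtype.ext h)
  have himg : Finset.univ.image x = Y := by
    ext w
    constructor
    · intro h
      obtain ⟨i, -, rfl⟩ := Finset.mem_image.1 h
      exact (Y.equivFin.symm i).2
    · intro hw
      exact Finset.mem_image.2 ⟨Y.equivFin ⟨w, hw⟩, Finset.mem_univ _, by simp [x]⟩
  rw [two_mul_interactionEnergy]
  simp only [siteEnergy]
  conv_lhs => rw [← himg]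
  rw [Finset.sum_image hx.injOn]
  refine Finset.sum_congr rfl fun i _ => ?_
  rw [← Finset.image_erase hx, Finset.sum_image hx.injOn]
  refine Finset.sum_congr rfl fun k _ => ?_
  rw [dist_eq_norm, norm_sub_rev]

/-- **Stub B (finite-cluster energy bound with boundary correction).** For `ρ ≥ 1`, a finite set `T`
of points of `ℝ³` and `Y ⊆ T`: `|Y| · e⋆ ≤ Σ_{w ∈ Y} [½ Σ_{z ∈ T∖{w}, ‖z−w‖ ≤ ρ} V_LJ ‖z − w‖ +
(1/24) #{z ∈ T ∖ Y : ‖z − w‖ ≤ ρ}]`, `e⋆ = ⨅_Q e(Q)`: the pairs inside `Y` carry at least the full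
interaction energy of `Y` (the dropped pairs beyond `ρ ≥ 1` have `V_LJ ≤ 0`), which is `≥ |Y| e⋆`
(`card_mul_eStar_le_interactionEnergy`, `bddBelow_energyPerParticle_lennardJones`); each cross pair
costs at most `−min V_LJ = 1/12`, paid by the boundary term. [folklore] -/
theorem stub_clusterEnergyBound :
    ∀ (ρ : ℝ), 1 ≤ ρ → ∀ (T Y : Finset (EuclideanSpace ℝ (Fin 3))), Y ⊆ T →
      (Y.card : ℝ) * (⨅ Q : Literature.MathematicalPhysics.StatisticalMechanics.PeriodicConfiguration 3,
          Q.energyPerParticle Literature.MathematicalPhysics.StatisticalMechanics.lennardJones) ≤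
        ∑ w ∈ Y, ((∑ z ∈ (T.erase w).filter (fun z => ‖z - w‖ ≤ ρ),
            Literature.MathematicalPhysics.StatisticalMechanics.lennardJones ‖z - w‖) / 2 +
          (1 / 24) * ((((T \ Y).filter (fun z => ‖z - w‖ ≤ ρ)).card : ℝ))) := by
  intro ρ hρ T Y hYT
  have hx : Function.Injective
      (fun i : Fin Y.card => (Y.equivFin.symm i : EuclideanSpace ℝ (Fin 3))) :=
    fun i j h => Y.equivFin.symm.injective (Subtype.ext h)
  have hE := card_mul_eStar_le_interactionEnergy bddBelow_energyPerParticle_lennardJones hx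
  have h2 := sum_sum_erase_eq_two_mul_interactionEnergy Y
  have h4 : ∑ w ∈ Y, (∑ z ∈ Y.erase w, lennardJones ‖z - w‖) / 2 ≤
      ∑ w ∈ Y, ((∑ z ∈ (T.erase w).filter (fun z => ‖z - w‖ ≤ ρ), lennardJones ‖z - w‖) / 2 +
          (1 / 24) * ((((T \ Y).filter (fun z => ‖z - w‖ ≤ ρ)).card : ℝ))) :=
    Finset.sum_le_sum fun w hw => clusterEnergyBound_site hρ hYT hw
  rw [← Finset.sum_div] at h4
  show (Y.card : ℝ) * eStar ≤ _
  linarith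

end Summit.AtomisticToContinuum.Crystallization.Theorems.PatternPricedCertificates

end
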